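import Literature.IUT.HodgeTheaters.GenuineFKitMergeInputsLiftsGammaInner
import Literature.AlgebraicGeometry.Frobenioids.PadicFrobenioidPerfMulTransport
import HarnessLib

/-!
# [IUTchI] Cor 5.3 (ii), surjectivity half at the genuine good place — the GENERAL lift: an automorphism `φ` of `Π_v ↠ G_v`
# covering ANY `β ∈ Aut(G_v)`, together with a `β⁻¹`-equivariant integral multiplicative `σ : K̄_vˣ ⥲ K̄_vˣ`, lifts to a
# self-equivalence of the genuine `𝒞_v` (abc-iut-w4-d047, row «LIFTSALL-ALL@GOOD» (ii); generalises racer B's Γ-inner `GammaInnerLift`)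

S. Mochizuki, *Inter-universal Teichmüller theory I*, kurims manuscript (May 2020), §5 Corollary 5.3 (ii) p. 144 l. 13–15 («the natural map
`Isom(¹𝔉, ²𝔉) → Isom(¹𝔇, ²𝔇)` [cf. Remark 5.2.1, (i)] is bijective») with its printed proof p. 144 l. 33–34 («follows immediately from
[AbsTopIII], Proposition 3.2, (iv); [AbsTopIII], Proposition 4.2, (i)»); Ex 3.3 (i) p. 78 ([IUTchI] Cor 5.3 (ii) p.144)
[claim: Mochizuki2012, status: disputed] (D-0012 claim key; CONSTRUCTIONS and PROOFS over landed files; nothing of the series is asserted; no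
side is taken on [IUTchIII] Cor. 3.12).  S. Mochizuki, *The geometry of Frobenioids I*, Thm. 5.2 (i) p. 100, Cor. 5.4 p. 104
[cite: MochizukiFrdI2008, Cor. 5.4 p.104]; *The geometry of Frobenioids II*, Ex. 1.1 (ii) p. 8, Ex. 1.3 (ii) p. 11
[cite: MochizukiFrdII2008, Ex 1.3 (ii) p.11].

## What this file proves (cell abc-iut, L5 HUB node `IUTchI:Cor5.3(ii)`; the σ-twisted version of abc-iut-L5-t16's `GammaInnerLift` §B)

abc-iut-L5-t16's `GammaInnerLift` (p503506) lifts an automorphism `φ` of `(P ↠ Γ) = (Π_v ↠ G_v)` that is Γ-INNER (`aug ∘ φ = conj γ ∘ aug`) to the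
genuine `𝒞_v = (GoodLocalFrobenioid.ofGalois d aug …).Cv` by `restrictAlong` of the natural ISOMORPHISM `pull φ ⋙ push aug ≅ push aug` — the
components of the data morphism are the datum's OWN maps.  For a GENERAL `φ` covering `β ∈ Aut(Γ)` (`aug ∘ φ = β ∘ aug`) there is no such
isomorphism; instead the monoid components are supplied by a multiplicative `σ : Ωˣ ⥲ Ωˣ` (`Ω = d.Ω = K̄_v`) with `σ (γ • x) = β⁻¹ γ • σ x`
and `v(x) ≤ 1 ↔ v(σ x) ≤ 1` — which abc-iut-w4-d047's `GoodLocalFrobenioidTransporterSigma` produces for EVERY transporter from L4's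
[AbsTopIII] Prop 3.2 (iv) / [AbsAnab] Prop 1.2.1 (vi) — fed through abc-iut-w4-d047's L1 brick `PadicFrd.perfMulTransport`:
* §A `SigmaLift.mem_mapOpen_comap_iff` — `g ∈ aug(φ⁻¹U) ↔ β g ∈ aug(U)`; `valuation_fieldObj_le_one_iff` (the restricted valuation of a fixed field
  `Ω^W` is that of `Ω`); `fixedUnitsMap` — `σ` restricted: `(Ω^{aug U})ˣ → (Ω^{aug(φ⁻¹U)})ˣ`, with `coe_fixedUnitsMap`;
* §B `SigmaLift.dataHomOver` — `perfMulTransport` at `F₁ := push aug ⋙ fieldFunctor`, `F₂ := (pull φ ⋙ push aug) ⋙ fieldFunctor` over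
  `CosetCat P`: a `ModelFrobenioid.DataHomOver (pull φ)` between `𝒞_v`'s OWN data (abc-iut-L1-t4 `perf_proj_eq_restrict`, rfl); integrality
  from the hypothesis on `σ`; NATURALITY from the equivariance of `σ` and the point-computations `pt_push_map`/`pt_pull_map_coe` of
  abc-iut-L5-t2/abc-iut-w4-d078 (`fixedHom_apply_coe`: any representative computes the field map);
* §C `SigmaLift.lift`, `lift_comp_toBase` (ON THE NOSE over `pull φ`, abc-iut-w5-d048 `functor_comp_baseFunctor`), `lift_isEquivalence`
  (abc-iut-w5-d137 `functor_isEquivalence`; bijective components from `σ⁻¹` via `perfMulTransportη/β_bijective`),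
  **`exists_selfEquivalence_liesUnder_pullSelfEquiv`** — for EVERY such `(φ, ψ, β, σ)`: a self-equivalence of `𝒞_v` (with functor THE lift)
  lying under `pullSelfEquiv φ ψ` through `toBase`.
Binders (displayed): `d, aug (hc hs ho), Kv hp` (t2's `ofGalois` inputs), `φ ψ` (mutually inverse, continuous), `β`, `hβ : aug ∘ φ = β ∘ aug`,
`σ`, `hσ`, `hσint`; 0 instance · 0 notation · no `Prop` fact; def-like declarations (8, census of record abc-iut-ref-g G45 / ref-q):
defs `unitsVal` (§A, the unit-group-valued inclusion `(↥E)ˣ →* Ωˣ` of an intermediate field), `fixedUnitsMap` (§A), `tau` (§B, the family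
`τ_A` fed to `perfMulTransport`), `dataHomOver` (§B), `lift` (§C), `tau'` (§C, the inverse family from `σ'`), and abbrevs `baseFunctor₁`,
`baseFunctor₂` (§B, `push aug ⋙ fieldFunctor` and `(pull φ ⋙ push aug) ⋙ fieldFunctor`).  HONEST FRAMING: OUR transport of
OUR datum; typed ≠ proved beyond what is here; nothing here asserts abc proved or refuted.
-/

noncomputable section

namespace Literature.IUT.HodgeTheaters

open CategoryTheory Opposite Literature.AnabelianGeometry.SemiGraphs Literature.AlgebraicGeometry.Frobenioids
open scoped ValuativeRel

namespace SigmaLift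

universe u

/-! ### §A. `aug(φ⁻¹U) = β⁻¹(aug U)`; fixed-field valuations; `σ` restricted to the fixed fields -/

section Cover

variable {P : Type u} [Group P] [TopologicalSpace P] {Γ : Type u} [Group Γ] [TopologicalSpace Γ]
  (aug : P →* Γ) (ho : IsOpenMap aug) (φ : P →* P) (hφc : Continuous φ) (hφs : Function.Surjective φ)
  (β : Γ ≃* Γ) (hβ : ∀ z : P, aug (φ z) = β (aug z))

include hφs hβ in
/-- For an automorphism `φ` of `P` covering `β` on `Γ` (`aug ∘ φ = β ∘ aug`): `g ∈ aug(φ⁻¹U)` iff `β g ∈ aug(U)`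
(generalises abc-iut-L5-t16's Γ-inner `mem_mapOpen_comap_iff`, `β = conj γ`). [cite: MochizukiFrdII2008, Ex 1.3 (ii) p.11] -/
theorem mem_mapOpen_comap_iff (U : OpenSubgroup P) (g : Γ) :
    g ∈ CosetCat.mapOpen aug ho (U.comap φ hφc) ↔ β g ∈ CosetCat.mapOpen aug ho U := by
  rw [CosetCat.mem_mapOpen, CosetCat.mem_mapOpen]
  constructor
  · rintro ⟨z, hz, rfl⟩
    exact ⟨φ z, OpenSubgroup.mem_comap.mp hz, by rw [hβ]⟩
  · rintro ⟨u, hu, hgu⟩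
    obtain ⟨z, rfl⟩ := hφs u
    refine ⟨z, OpenSubgroup.mem_comap.mpr hu, β.injective ?_⟩
    rw [← hβ, hgu]

end Cover

section Fields

variable {p : ℕ} [Fact p.Prime] (d : GaloisValDatum.{u} p)

/-- The restricted valuation of a fixed field `Ω^W` (abc-iut-L5-t2 `valOn`) takes values `≤ 1` exactly on the elements of `Ω`-valuation `≤ 1`.
[cite: MochizukiFrdII2008, Ex 1.1 (i) p.7] -/
theorem valuation_fieldObj_le_one_iff (Y : CosetCat d.Gal) (x : ↥(d.fixedFld Y)) :
    @ValuativeRel.valuation (↥(d.fixedFld Y)) _ (d.valOn (d.fixedFld Y)) x ≤ 1 ↔ ValuativeRel.valuation d.Ω (x : d.Ω) ≤ 1 := by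
  letI : ValuativeRel (↥(d.fixedFld Y)) := d.valOn (d.fixedFld Y)
  have h1 : ValuativeRel.valuation (↥(d.fixedFld Y)) x ≤ 1 ↔ x ≤ᵥ (1 : ↥(d.fixedFld Y)) := by
    rw [← (ValuativeRel.valuation (↥(d.fixedFld Y))).map_one, ← Valuation.Compatible.vle_iff_le]
  rw [h1, d.valOn_iff, Valuation.Compatible.vle_iff_le (v := ValuativeRel.valuation d.Ω), OneMemClass.coe_one, map_one]

/-- The units of an intermediate field `E ⊆ Ω` read in `Ωˣ` (the inclusion on units). [cite: MochizukiFrdII2008, Ex 1.1 (i) p.7] -/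
def unitsVal (E : IntermediateField d.k d.Ω) : (↥E)ˣ →* d.Ωˣ :=
  Units.map ((algebraMap (↥E) d.Ω : ↥E →+* d.Ω) : ↥E →* d.Ω)

/-- The value of `unitsVal`. [cite: MochizukiFrdII2008, Ex 1.1 (i) p.7] -/
@[simp] theorem coe_unitsVal (E : IntermediateField d.k d.Ω) (u : (↥E)ˣ) : ((unitsVal d E u : d.Ωˣ) : d.Ω) = ((u : ↥E) : d.Ω) := rfl

/-- `unitsVal` is injective. [cite: MochizukiFrdII2008, Ex 1.1 (i) p.7] -/
theorem unitsVal_injective (E : IntermediateField d.k d.Ω) : Function.Injective (unitsVal d E) := fun u v h =>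
  Units.ext (Subtype.ext (by simpa only [coe_unitsVal] using congrArg (fun w : d.Ωˣ => (w : d.Ω)) h))

variable (σ : d.Ωˣ →* d.Ωˣ)

/-- **`σ` RESTRICTED to units of fixed fields**: a multiplicative `σ : Ωˣ → Ωˣ` mapping the units of the intermediate field `E₁` into `E₂`
induces `E₁ˣ → E₂ˣ` (multiplicative; no additivity is used or available). [cite: MochizukiFrdII2008, Ex 1.1 (i) p.7] -/
def fixedUnitsMap (E₁ E₂ : IntermediateField d.k d.Ω) (h : ∀ u : (↥E₁)ˣ, (σ (unitsVal d E₁ u) : d.Ω) ∈ E₂) : (↥E₁)ˣ →* (↥E₂)ˣ where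
  toFun u :=
    ⟨⟨(σ (unitsVal d E₁ u) : d.Ω), h u⟩,
      ⟨((σ (unitsVal d E₁ u))⁻¹ : d.Ωˣ), by
        have h' := h u⁻¹
        rwa [map_inv, map_inv] at h'⟩,
      Subtype.ext (Units.mul_inv _), Subtype.ext (Units.inv_mul _)⟩
  map_one' := Units.ext (Subtype.ext (by
    change ((σ (unitsVal d E₁ 1) : d.Ωˣ) : d.Ω) = 1
    rw [map_one, map_one, Units.val_one]))
  map_mul' u v := Units.ext (Subtype.ext (by
    change ((σ (unitsVal d E₁ (u * v)) : d.Ωˣ) : d.Ω) = (σ (unitsVal d E₁ u) : d.Ω) * (σ (unitsVal d E₁ v) : d.Ω)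
    rw [map_mul, map_mul, Units.val_mul]))

/-- The value of `fixedUnitsMap` in `Ω`. [cite: MochizukiFrdII2008, Ex 1.1 (i) p.7] -/
@[simp] theorem coe_fixedUnitsMap (E₁ E₂ : IntermediateField d.k d.Ω) (h : ∀ u : (↥E₁)ˣ, (σ (unitsVal d E₁ u) : d.Ω) ∈ E₂) (u : (↥E₁)ˣ) :
    (((fixedUnitsMap d σ E₁ E₂ h u : (↥E₂)ˣ) : ↥E₂) : d.Ω) = (σ (unitsVal d E₁ u) : d.Ω) := rfl

/-- `fixedUnitsMap` read in `Ωˣ` is `σ`. [cite: MochizukiFrdII2008, Ex 1.1 (i) p.7] -/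
theorem unitsVal_fixedUnitsMap (E₁ E₂ : IntermediateField d.k d.Ω) (h : ∀ u : (↥E₁)ˣ, (σ (unitsVal d E₁ u) : d.Ω) ∈ E₂) (u : (↥E₁)ˣ) :
    unitsVal d E₂ (fixedUnitsMap d σ E₁ E₂ h u) = σ (unitsVal d E₁ u) :=
  Units.ext rfl

end Fields

/-! ### §B. The data morphism over `pull φ` at the REAL `GoodLocalFrobenioid.ofGalois` from `(φ, β, σ)` -/

section Lift

variable {p : ℕ} [Fact p.Prime] (d : GaloisValDatum.{u} p) {P : Type u} [Group P] [TopologicalSpace P]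
  (aug : P →* d.Gal) (hc : Continuous aug) (hs : Function.Surjective aug) (ho : IsOpenMap aug)
  (Kv : Type) [Field Kv] [ValuativeRel Kv] (hp : ((p : Kv)) ∈ PadicFrd.intNonzero Kv)
  (φ : P →* P) (hφc : Continuous φ) (hφs : Function.Surjective φ)
  (β : d.Gal ≃* d.Gal) (hβ : ∀ z : P, aug (φ z) = β (aug z))
  (σ : d.Ωˣ →* d.Ωˣ) (hσ : ∀ (γ : d.Gal) (x : d.Ωˣ), σ (γ • x) = β.symm γ • σ x)
  (hσint : ∀ x : d.Ωˣ, ValuativeRel.valuation d.Ω (x : d.Ω) ≤ 1 → ValuativeRel.valuation d.Ω (σ x : d.Ω) ≤ 1)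

/-- The base functor of `𝒞_v`'s datum: `P/U ↦ Ω^{aug U}` (push, then abc-iut-L5-t2's field functor). [cite: Mochizuki2012, I Ex 3.3 (i) p.78] -/
abbrev baseFunctor₁ : CosetCat P ⥤ PadicFrd.PadicFld.{u} p := CosetCat.push aug ho ⋙ d.fieldFunctor

/-- The same precomposed with `pull φ`: `P/U ↦ Ω^{aug(φ⁻¹U)}`. [cite: Mochizuki2012, I Ex 3.3 (i) p.78] -/
abbrev baseFunctor₂ : CosetCat P ⥤ PadicFrd.PadicFld.{u} p := (CosetCat.pull φ hφc hφs ⋙ CosetCat.push aug ho) ⋙ d.fieldFunctor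

include hφs hβ hσ in
/-- `σ` maps the units of `Ω^{aug U}` into `Ω^{aug(φ⁻¹U)} = Ω^{β⁻¹(aug U)}`: for `g ∈ aug(φ⁻¹U)`, `β g` fixes `x`, and `σ x = σ (β g • x) = g • σ x`.
[cite: Mochizuki2012, I Ex 3.3 (i) p.78] -/
theorem sigma_mem_fixedFld (X : CosetCat P) (u : (↥(d.fixedFld ((CosetCat.push aug ho).obj X)))ˣ) :
    (σ (unitsVal d (d.fixedFld ((CosetCat.push aug ho).obj X)) u) : d.Ω) ∈
      d.fixedFld ((CosetCat.push aug ho).obj ((CosetCat.pull φ hφc hφs).obj X)) := by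
  refine (IntermediateField.mem_fixedField_iff _ _).mpr fun g hg => ?_
  have hg' : β g ∈ CosetCat.mapOpen aug ho X.sg := (mem_mapOpen_comap_iff aug ho φ hφc hφs β hβ X.sg g).mp hg
  have hfix : β g • (unitsVal d (d.fixedFld ((CosetCat.push aug ho).obj X)) u) = unitsVal d (d.fixedFld ((CosetCat.push aug ho).obj X)) u := by
    apply Units.ext
    change (β g) ((u : ↥(d.fixedFld ((CosetCat.push aug ho).obj X))) : d.Ω) = _
    exact (IntermediateField.mem_fixedField_iff _ _).mp (u : ↥(d.fixedFld ((CosetCat.push aug ho).obj X))).2 _ hg'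
  have key := hσ (β g) (unitsVal d (d.fixedFld ((CosetCat.push aug ho).obj X)) u)
  rw [hfix, MulEquiv.symm_apply_apply] at key
  -- key : σ U = g • σ U
  exact (congrArg (fun w : d.Ωˣ => (w : d.Ω)) key).symm

/-- **The family `τ_X = σ|` of multiplicative maps `(Ω^{aug U_X})ˣ → (Ω^{aug(φ⁻¹U_X)})ˣ`** fed to abc-iut-w4-d047's brick `perfMulTransport`.
[cite: Mochizuki2012, I Ex 3.3 (i) p.78] -/
def tau (X : CosetCat P) : ((baseFunctor₁ d aug ho).obj X).Kˣ →* ((baseFunctor₂ d aug ho φ hφc hφs).obj X).Kˣ :=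
  fixedUnitsMap d σ _ _ (sigma_mem_fixedFld d aug ho φ hφc hφs β hβ σ hσ X)

/-- `τ_X` read in `Ωˣ` is `σ`. [cite: Mochizuki2012, I Ex 3.3 (i) p.78] -/
theorem unitsVal_tau (X : CosetCat P) (u : ((baseFunctor₁ d aug ho).obj X).Kˣ) :
    unitsVal d (d.fixedFld ((CosetCat.push aug ho).obj ((CosetCat.pull φ hφc hφs).obj X))) (tau d aug ho φ hφc hφs β hβ σ hσ X u) =
      σ (unitsVal d (d.fixedFld ((CosetCat.push aug ho).obj X)) u) :=
  Units.ext rfl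

include hσint in
/-- `τ` carries integral units to integral units (the valuation of a fixed field is the restricted one). [cite: MochizukiFrdII2008, Ex 1.1 (i) p.7] -/
theorem tau_integral (X : CosetCat P) (u : ((baseFunctor₁ d aug ho).obj X).Kˣ)
    (hu : ValuativeRel.valuation ((baseFunctor₁ d aug ho).obj X).K (u : ((baseFunctor₁ d aug ho).obj X).K) ≤ 1) :
    ValuativeRel.valuation ((baseFunctor₂ d aug ho φ hφc hφs).obj X).K
      (tau d aug ho φ hφc hφs β hβ σ hσ X u : ((baseFunctor₂ d aug ho φ hφc hφs).obj X).K) ≤ 1 := by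
  have hu' : ValuativeRel.valuation d.Ω ((unitsVal d (d.fixedFld ((CosetCat.push aug ho).obj X)) u : d.Ωˣ) : d.Ω) ≤ 1 :=
    (valuation_fieldObj_le_one_iff d ((CosetCat.push aug ho).obj X) (Units.val u)).mp hu
  have h2 := hσint _ hu'
  exact (valuation_fieldObj_le_one_iff d ((CosetCat.push aug ho).obj ((CosetCat.pull φ hφc hφs).obj X))
    (Units.val (tau d aug ho φ hφc hφs β hβ σ hσ X u))).mpr h2

include hβ hσ in
/-- **NATURALITY of `τ`** for the pull-back maps of `B₀` along a morphism `f : X' ⟶ X` of `CosetCat P` (point `φ w · U_X`): both composites send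
a unit `u` of `Ω^{aug U_X}` to `(aug w) · σ u` — `(F₁ f)^* u = β(aug w) · u` (`pt (push f) = aug(φ w) = β(aug w)`), `σ (β(aug w) · u) = aug w · σ u`,
and `(F₂ f)^* = aug w · (−)` (`pt (push (pull φ f)) = aug w`, abc-iut-w4-d078 `pt_pull_map_coe`). [cite: MochizukiFrdII2008, Ex 1.3 (ii) p.11] -/
theorem tau_natural {X X' : CosetCat P} (f : X' ⟶ X) (u : ((baseFunctor₁ d aug ho).obj X).Kˣ) :
    tau d aug ho φ hφc hφs β hβ σ hσ X'
        (Units.map (((baseFunctor₁ d aug ho).map f).alg : ((baseFunctor₁ d aug ho).obj X).K →* ((baseFunctor₁ d aug ho).obj X').K) u) =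
      Units.map (((baseFunctor₂ d aug ho φ hφc hφs).map f).alg :
          ((baseFunctor₂ d aug ho φ hφc hφs).obj X).K →* ((baseFunctor₂ d aug ho φ hφc hφs).obj X').K)
        (tau d aug ho φ hφc hφs β hβ σ hσ X u) := by
  -- a representative `φ w` of the point of `f`
  obtain ⟨a, ha⟩ := QuotientGroup.mk_surjective (CosetCat.pt f)
  obtain ⟨w, rfl⟩ := hφs a
  have hpush : CosetCat.pt ((CosetCat.push aug ho).map f) = ((β (aug w) : d.Gal) : ((CosetCat.push aug ho).obj X).carrier) := by
    rw [CosetCat.pt_push_map, ← ha, CosetCat.pushQuot_coe, hβ]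
  have hpull : CosetCat.pt ((CosetCat.pull φ hφc hφs).map f) = ((w : P) : ((CosetCat.pull φ hφc hφs).obj X).carrier) :=
    CosetCat.pt_pull_map_coe φ hφc hφs f ha.symm rfl
  have hpush' : CosetCat.pt ((CosetCat.push aug ho).map ((CosetCat.pull φ hφc hφs).map f)) =
      ((aug w : d.Gal) : ((CosetCat.push aug ho).obj ((CosetCat.pull φ hφc hφs).obj X)).carrier) := by
    rw [CosetCat.pt_push_map, hpull, CosetCat.pushQuot_coe]
  -- compare in `Ωˣ`
  apply unitsVal_injective d
  have t1 := unitsVal_tau d aug ho φ hφc hφs β hβ σ hσ X'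
    (Units.map (((baseFunctor₁ d aug ho).map f).alg : ((baseFunctor₁ d aug ho).obj X).K →* ((baseFunctor₁ d aug ho).obj X').K) u)
  have t2 := unitsVal_tau d aug ho φ hφc hφs β hβ σ hσ X u
  -- left: `σ (β(aug w) • U) = aug w • σ U`
  have e₁ : unitsVal d (d.fixedFld ((CosetCat.push aug ho).obj X'))
      (Units.map (((baseFunctor₁ d aug ho).map f).alg : ((baseFunctor₁ d aug ho).obj X).K →* ((baseFunctor₁ d aug ho).obj X').K) u) =
      β (aug w) • unitsVal d (d.fixedFld ((CosetCat.push aug ho).obj X)) u := by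
    apply Units.ext
    change ((d.fixedHom ((CosetCat.push aug ho).map f) (Units.val u) : ↥(d.fixedFld ((CosetCat.push aug ho).obj X'))) : d.Ω) =
      (β (aug w)) ((Units.val u : ↥(d.fixedFld ((CosetCat.push aug ho).obj X))) : d.Ω)
    exact d.fixedHom_apply_coe _ _ hpush _
  -- right: `(F₂ f)^* (τ u) = aug w • σ U`
  have e₂ : unitsVal d (d.fixedFld ((CosetCat.push aug ho).obj ((CosetCat.pull φ hφc hφs).obj X')))
      (Units.map (((baseFunctor₂ d aug ho φ hφc hφs).map f).alg :
          ((baseFunctor₂ d aug ho φ hφc hφs).obj X).K →* ((baseFunctor₂ d aug ho φ hφc hφs).obj X').K)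
        (tau d aug ho φ hφc hφs β hβ σ hσ X u)) =
      aug w • unitsVal d (d.fixedFld ((CosetCat.push aug ho).obj ((CosetCat.pull φ hφc hφs).obj X))) (tau d aug ho φ hφc hφs β hβ σ hσ X u) := by
    apply Units.ext
    change ((d.fixedHom ((CosetCat.push aug ho).map ((CosetCat.pull φ hφc hφs).map f))
      (Units.val (tau d aug ho φ hφc hφs β hβ σ hσ X u)) : ↥(d.fixedFld ((CosetCat.push aug ho).obj ((CosetCat.pull φ hφc hφs).obj X')))) : d.Ω) = _
    exact d.fixedHom_apply_coe _ _ hpush' _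
  rw [e₁, hσ, MulEquiv.symm_apply_apply] at t1
  exact t1.trans ((congrArg (fun v : d.Ωˣ => aug w • v) t2.symm).trans e₂.symm)

/-- **THE DATA MORPHISM OVER `pull φ` induced by `(φ, β, σ)`**: abc-iut-w4-d047's brick `PadicFrd.perfMulTransport` at the base functors
`push aug ⋙ fieldFunctor` and `(pull φ ⋙ push aug) ⋙ fieldFunctor` over `CosetCat P` — by abc-iut-L1-t4's `perf_proj_eq_restrict` (rfl) this IS
a `DataHomOver (pull φ)` between `𝒞_v`'s own data. [cite: MochizukiFrdI2008, Thm. 5.2(i) p.100] -/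
def dataHomOver :
    ModelFrobenioid.DataHomOver (CosetCat.pull φ hφc hφs)
      (PadicFrd.Datum.perf (CosetCat.push aug ho ⋙ d.fieldFunctor)
        (GoodLocalFrobenioid.hlocOver (CosetCat.push aug ho) d.fieldFunctor d.fieldFunctor_isPadicLocal)
        CosetCat.isConnected CosetCat.isTotallyEpimorphic).divB
      (PadicFrd.Datum.perf (CosetCat.push aug ho ⋙ d.fieldFunctor)
        (GoodLocalFrobenioid.hlocOver (CosetCat.push aug ho) d.fieldFunctor d.fieldFunctor_isPadicLocal)
        CosetCat.isConnected CosetCat.isTotallyEpimorphic).divB :=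
  PadicFrd.perfMulTransport (baseFunctor₁ d aug ho) (baseFunctor₂ d aug ho φ hφc hφs)
    (GoodLocalFrobenioid.hlocOver (CosetCat.push aug ho) d.fieldFunctor d.fieldFunctor_isPadicLocal)
    (GoodLocalFrobenioid.hlocOver (CosetCat.pull φ hφc hφs ⋙ CosetCat.push aug ho) d.fieldFunctor d.fieldFunctor_isPadicLocal)
    CosetCat.isConnected CosetCat.isTotallyEpimorphic (tau d aug ho φ hφc hφs β hβ σ hσ)
    (tau_integral d aug ho φ hφc hφs β hβ σ hσ hσint) (fun f u => tau_natural d aug ho φ hφc hφs β hβ σ hσ f u)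

/-! ### §C. The lift and its properties -/

/-- **THE LIFT `Ψ_{φ,σ} : 𝒞_v ⥤ 𝒞_v`** (the functor of `dataHomOver`: `(A, α) ↦ (φ⁻¹A, (ord σ)^gp α)` — the surjectivity half, here for an ARBITRARY
transporter via its anabelian `σ`). ([IUTchI] Cor 5.3 (ii) p.144) [claim: Mochizuki2012, status: disputed] -/
def lift : (GoodLocalFrobenioid.ofGalois d aug hc hs ho Kv hp).Cv ⥤ (GoodLocalFrobenioid.ofGalois d aug hc hs ho Kv hp).Cv :=
  (dataHomOver d aug ho φ hφc hφs β hβ σ hσ hσint).functor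

/-- **`Ψ_{φ,σ}` LIES OVER `pull φ` ON THE NOSE** (abc-iut-w5-d048 `DataHomOver.functor_comp_baseFunctor`).
([IUTchI] Cor 5.3 (ii) p.144) [claim: Mochizuki2012, status: disputed] -/
theorem lift_comp_toBase :
    lift d aug hc hs ho Kv hp φ hφc hφs β hβ σ hσ hσint ⋙ (GoodLocalFrobenioid.ofGalois d aug hc hs ho Kv hp).toBase =
      (GoodLocalFrobenioid.ofGalois d aug hc hs ho Kv hp).toBase ⋙ CosetCat.pull φ hφc hφs :=
  (dataHomOver d aug ho φ hφc hφs β hβ σ hσ hσint).functor_comp_baseFunctor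

variable (ψ : P →* P) (hψc : Continuous ψ) (h₁ : φ.comp ψ = MonoidHom.id P) (h₂ : ψ.comp φ = MonoidHom.id P)
  (σ' : d.Ωˣ →* d.Ωˣ) (hσ' : ∀ (γ : d.Gal) (x : d.Ωˣ), σ' (γ • x) = β γ • σ' x)
  (hσ'int : ∀ x : d.Ωˣ, ValuativeRel.valuation d.Ω (x : d.Ω) ≤ 1 → ValuativeRel.valuation d.Ω (σ' x : d.Ω) ≤ 1)
  (hinv : ∀ x, σ' (σ x) = x) (hinv' : ∀ x, σ (σ' x) = x)

include hφs hβ hσ' in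
/-- The inverse family `τ'_X = σ'|` maps units of `Ω^{aug(φ⁻¹U)}` back into `Ω^{aug U}` (`σ'` is `β`-equivariant).
[cite: Mochizuki2012, I Ex 3.3 (i) p.78] -/
theorem sigma'_mem_fixedFld (X : CosetCat P) (u : (↥(d.fixedFld ((CosetCat.push aug ho).obj ((CosetCat.pull φ hφc hφs).obj X))))ˣ) :
    (σ' (unitsVal d (d.fixedFld ((CosetCat.push aug ho).obj ((CosetCat.pull φ hφc hφs).obj X))) u) : d.Ω) ∈
      d.fixedFld ((CosetCat.push aug ho).obj X) := by
  refine (IntermediateField.mem_fixedField_iff _ _).mpr fun g hg => ?_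
  have hg' : β.symm g ∈ CosetCat.mapOpen aug ho (X.sg.comap φ hφc) := by
    refine (mem_mapOpen_comap_iff aug ho φ hφc hφs β hβ X.sg (β.symm g)).mpr ?_
    rw [MulEquiv.apply_symm_apply]; exact hg
  have hfix : β.symm g • (unitsVal d (d.fixedFld ((CosetCat.push aug ho).obj ((CosetCat.pull φ hφc hφs).obj X))) u) =
      unitsVal d (d.fixedFld ((CosetCat.push aug ho).obj ((CosetCat.pull φ hφc hφs).obj X))) u := by
    apply Units.ext
    change (β.symm g) ((u : ↥(d.fixedFld ((CosetCat.push aug ho).obj ((CosetCat.pull φ hφc hφs).obj X)))) : d.Ω) = _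
    exact (IntermediateField.mem_fixedField_iff _ _).mp
      (u : ↥(d.fixedFld ((CosetCat.push aug ho).obj ((CosetCat.pull φ hφc hφs).obj X)))).2 _ hg'
  have key := hσ' (β.symm g) (unitsVal d (d.fixedFld ((CosetCat.push aug ho).obj ((CosetCat.pull φ hφc hφs).obj X))) u)
  rw [hfix, MulEquiv.apply_symm_apply] at key
  exact (congrArg (fun w : d.Ωˣ => (w : d.Ω)) key).symm

/-- The inverse family `τ'`. [cite: Mochizuki2012, I Ex 3.3 (i) p.78] -/
def tau' (X : CosetCat P) : ((baseFunctor₂ d aug ho φ hφc hφs).obj X).Kˣ →* ((baseFunctor₁ d aug ho).obj X).Kˣ :=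
  fixedUnitsMap d σ' _ _ (sigma'_mem_fixedFld d aug ho φ hφc hφs β hβ σ' hσ' X)

include hσ'int in
/-- `τ'` carries integral units to integral units. [cite: MochizukiFrdII2008, Ex 1.1 (i) p.7] -/
theorem tau'_integral (X : CosetCat P) (u : ((baseFunctor₂ d aug ho φ hφc hφs).obj X).Kˣ)
    (hu : ValuativeRel.valuation ((baseFunctor₂ d aug ho φ hφc hφs).obj X).K (u : ((baseFunctor₂ d aug ho φ hφc hφs).obj X).K) ≤ 1) :
    ValuativeRel.valuation ((baseFunctor₁ d aug ho).obj X).K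
      (tau' d aug ho φ hφc hφs β hβ σ' hσ' X u : ((baseFunctor₁ d aug ho).obj X).K) ≤ 1 := by
  have hu' : ValuativeRel.valuation d.Ω
      ((unitsVal d (d.fixedFld ((CosetCat.push aug ho).obj ((CosetCat.pull φ hφc hφs).obj X))) u : d.Ωˣ) : d.Ω) ≤ 1 :=
    (valuation_fieldObj_le_one_iff d ((CosetCat.push aug ho).obj ((CosetCat.pull φ hφc hφs).obj X)) (Units.val u)).mp hu
  have h2 := hσ'int _ hu'
  exact (valuation_fieldObj_le_one_iff d ((CosetCat.push aug ho).obj X) (Units.val (tau' d aug ho φ hφc hφs β hβ σ' hσ' X u))).mpr h2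

include hinv in
/-- `τ' ∘ τ = id`. [cite: Mochizuki2012, I Ex 3.3 (i) p.78] -/
theorem tau'_tau (X : CosetCat P) (u : ((baseFunctor₁ d aug ho).obj X).Kˣ) :
    tau' d aug ho φ hφc hφs β hβ σ' hσ' X (tau d aug ho φ hφc hφs β hβ σ hσ X u) = u := by
  apply unitsVal_injective d
  change unitsVal d _ (fixedUnitsMap d σ' _ _ _ (fixedUnitsMap d σ _ _ _ u)) = _
  rw [unitsVal_fixedUnitsMap, unitsVal_fixedUnitsMap, hinv]

include hinv' in
/-- `τ ∘ τ' = id`. [cite: Mochizuki2012, I Ex 3.3 (i) p.78] -/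
theorem tau_tau' (X : CosetCat P) (u : ((baseFunctor₂ d aug ho φ hφc hφs).obj X).Kˣ) :
    tau d aug ho φ hφc hφs β hβ σ hσ X (tau' d aug ho φ hφc hφs β hβ σ' hσ' X u) = u := by
  apply unitsVal_injective d
  change unitsVal d _ (fixedUnitsMap d σ _ _ _ (fixedUnitsMap d σ' _ _ _ u)) = _
  rw [unitsVal_fixedUnitsMap, unitsVal_fixedUnitsMap, hinv']

include ψ hψc h₁ h₂ σ' hσ' hσ'int hinv hinv' in
/-- **`Ψ_{φ,σ}` is an EQUIVALENCE** when `φ` has a continuous inverse `ψ` and `σ` an integral `β`-equivariant inverse `σ'` ([FrdI] Cor 5.4, the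
comparison functors are equivalences of categories: abc-iut-w5-d137 `functor_isEquivalence` over the equivalence `pull φ`, bijective components by
abc-iut-w4-d047 `perfMulTransportη/β_bijective`). [cite: MochizukiFrdI2008, Cor. 5.4 p.104] -/
theorem lift_isEquivalence : (lift d aug hc hs ho Kv hp φ hφc hφs β hβ σ hσ hσint).IsEquivalence := by
  haveI : (CosetCat.pull φ hφc hφs).IsEquivalence := (PiTransport.pullSelfEquiv φ ψ hφc hψc h₁ h₂).isEquivalence_functor
  refine (dataHomOver d aug ho φ hφc hφs β hβ σ hσ hσint).functor_isEquivalence (fun X => ?_) (fun X => ?_)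
  · exact PadicFrd.perfMulTransportη_bijective (baseFunctor₁ d aug ho) (baseFunctor₂ d aug ho φ hφc hφs)
      (tau d aug ho φ hφc hφs β hβ σ hσ) (tau' d aug ho φ hφc hφs β hβ σ' hσ')
      (tau_integral d aug ho φ hφc hφs β hβ σ hσ hσint) (tau'_integral d aug ho φ hφc hφs β hβ σ' hσ' hσ'int)
      (tau'_tau d aug ho φ hφc hφs β hβ σ hσ σ' hσ' hinv) (tau_tau' d aug ho φ hφc hφs β hβ σ hσ σ' hσ' hinv') X
  · exact PadicFrd.perfMulTransportβ_bijective (baseFunctor₁ d aug ho) (baseFunctor₂ d aug ho φ hφc hφs)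
      (GoodLocalFrobenioid.hlocOver (CosetCat.push aug ho) d.fieldFunctor d.fieldFunctor_isPadicLocal)
      (GoodLocalFrobenioid.hlocOver (CosetCat.pull φ hφc hφs ⋙ CosetCat.push aug ho) d.fieldFunctor d.fieldFunctor_isPadicLocal)
      (tau d aug ho φ hφc hφs β hβ σ hσ) (tau' d aug ho φ hφc hφs β hβ σ' hσ')
      (tau_integral d aug ho φ hφc hφs β hβ σ hσ hσint) (tau'_integral d aug ho φ hφc hφs β hβ σ' hσ' hσ'int)
      (tau'_tau d aug ho φ hφc hφs β hβ σ hσ σ' hσ' hinv) (tau_tau' d aug ho φ hφc hφs β hβ σ hσ σ' hσ' hinv') (op X)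

include hφs β hβ σ hσ hσint ψ hψc h₁ h₂ σ' hσ' hσ'int hinv hinv' in
/-- **THE GENERAL LIFT AT THE REAL `𝒞_v`**: for every automorphism `φ` of `Π_v` with continuous inverse, covering ANY `β ∈ Aut(G_v)`
(`aug ∘ φ = β ∘ aug`), and every `β⁻¹`-equivariant integral multiplicative `σ : K̄_vˣ ⥲ K̄_vˣ` (integral inverse `σ'`), there is a self-equivalence of
`𝒞_v = (GoodLocalFrobenioid.ofGalois d aug …).Cv` LYING UNDER the transport `pullSelfEquiv φ ψ` of `ℬ(Π_v)⁰` through `toBase` — print's route through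
[AbsTopIII] Prop 3.2 (iv), as a THEOREM about abc-iut-L5-t2's construction once `σ` is given (and abc-iut-w4-d047's
`sigmaTransporter` gives it for every transporter). ([IUTchI] Cor 5.3 (ii) p.144) [claim: Mochizuki2012, status: disputed] -/
theorem exists_selfEquivalence_liesUnder_pullSelfEquiv :
    ∃ Ψ : (GoodLocalFrobenioid.ofGalois d aug hc hs ho Kv hp).Cv ≌ (GoodLocalFrobenioid.ofGalois d aug hc hs ho Kv hp).Cv,
      Ψ.functor = lift d aug hc hs ho Kv hp φ hφc hφs β hβ σ hσ hσint ∧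
      Nonempty (CatIsomorphism.LiesUnder (GoodLocalFrobenioid.ofGalois d aug hc hs ho Kv hp).toBase
        (GoodLocalFrobenioid.ofGalois d aug hc hs ho Kv hp).toBase Ψ (PiTransport.pullSelfEquiv φ ψ hφc hψc h₁ h₂)) := by
  haveI := lift_isEquivalence d aug hc hs ho Kv hp φ hφc hφs β hβ σ hσ hσint ψ hψc h₁ h₂ σ' hσ' hσ'int hinv hinv'
  refine ⟨(lift d aug hc hs ho Kv hp φ hφc hφs β hβ σ hσ hσint).asEquivalence, rfl, ⟨?_⟩⟩
  change lift d aug hc hs ho Kv hp φ hφc hφs β hβ σ hσ hσint ⋙ (GoodLocalFrobenioid.ofGalois d aug hc hs ho Kv hp).toBase ≅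
    (GoodLocalFrobenioid.ofGalois d aug hc hs ho Kv hp).toBase ⋙ CosetCat.pull φ hφc _
  exact eqToIso (lift_comp_toBase d aug hc hs ho Kv hp φ hφc hφs β hβ σ hσ hσint)

end Lift

end SigmaLift

end Literature.IUT.HodgeTheaters

end
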